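import Mathlib
import HarnessLib
import Summits.HubbardSuperconductivity.HubbardSuperconductivity.Theorems.KLProgrammeH10TwoPointLimitPerturbedSectorBox

/-!
# Route `KLProgramme` — K1/K3 (stmt-HubbardSuperconductivity-19938 / 20437), located item «(L−3)-FRAME-UNIFORM-c», datum (u3) UNIFORM:
# BGM 2003 Lemma 7.3 (sector box + tangential derivative) for the perturbed Fermi curve with ONE constant for the whole family
# `{δ ∈ C² : |δ| ≤ κ₀, ‖Dδ‖ ≤ κ₁, ‖D²δ‖ ≤ κ₂}` and every admissible level `μ`

Cell gate-hubbard-kl, seat p4 (C5a), g12.  `sectorBox_perturbed` (`…PerturbedSectorBox`, p586461) proves BGM 2003 Lemma 7.3 for the chart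
`u₂ θ e := perturbedFermiRadius δ (μ + e) θ` with a constant `c₃ = R₁ + 2R₂ + (4 + κ₂)S_E R₂/u_min + 1` that is explicit in the band constants
`B`, the sizes `κ₁, κ₂` and the shell `e₀` ONLY — but packages it as `∃ c₃` AFTER the binders `δ, μ`.  The frame-uniform `(L−3)` sector count
(«(L−3)-FRAME-UNIFORM-c», hypothesis `h73` of `FermiRG.BGM2003.lemma31_sectorCounting_of_constants` along the family of admissible frames) needs the
constant BEFORE `δ, μ`: this file re-runs the same proof with the existential in front (`sectorBox_perturbed_uniform`).  Normal coefficient = radial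
level shift `|e|/(Dt_min − κ₁)` + second-order deviation `2S_E A_E(θ − θ_c)²`; tangential = cell size; gradient = tangency at `p⃗_F` + Lipschitz of
`∇(ε₀ + δ)` — verbatim the g11 argument.  Everything is PROVED; no definitions, no named facts.
References: BGM 2003 §7.1 Lemma 7.3 (A1.13)–(A1.14) [cite: BenfattoGiulianiMastropietro2003]; BGM 2006 §2.4 Lemma 2.1 [cite: BenfattoGiulianiMastropietro2006].
-/

noncomputable section

namespace Summit.HubbardSuperconductivity.HubbardSuperconductivity.Theorems.PerturbedFermiCurve

set_option linter.dupNamespace false -- summit = problem name (single-conjunct summit), D-0017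

open Real Set
open Literature.MathematicalPhysics.QuantumLattice Literature.MathematicalPhysics.QuantumLattice.BandSectorCounting
open Literature.MathematicalPhysics.QuantumLattice.FermiRG

set_option maxHeartbeats 1600000 in
/-- **BGM 2003 Lemma 7.3 for the perturbed curve, ONE constant for the family.**  Given the band constants `B : BandBounds a b`, sizes
`0 ≤ κ₁ < Dt_min`, `0 ≤ κ₂` and a shell `0 < e₀`, there is `c₃ > 0` (namely `R₁ + 2R₂ + (4 + κ₂)S_E R₂/u_min + 1` of `sectorBox_perturbed`) such that
for EVERY `δ ∈ C²` with `|δ| ≤ κ₀`, `‖Dδ‖ ≤ κ₁`, `‖D²δ‖ ≤ κ₂` and EVERY level `μ` with `[μ − κ₀ − e₀, μ + κ₀ + e₀] ⊂ [a, b]`: every `p ∈ S_{n,ω}`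
(s-sector of the chart `u₂ θ e = perturbedFermiRadius δ (μ+e) θ`, shell `e₀`) is `p⃗_F(θ_{n,ω}) + k₁n⃗ + k₂τ⃗` with `|k₁| ≤ c₃4^{−n}`,
`|k₂| ≤ c₃2^{−n}`, `|∇(ε₀+δ)(p)·τ⃗| ≤ c₃2^{−n}`. [cite: BenfattoGiulianiMastropietro2003, §7.1 Lemma 7.3 (A1.13)–(A1.14)] -/
theorem sectorBox_perturbed_uniform {a b : ℝ} (B : BandBounds a b) {κ₀ κ₁ κ₂ e₀ : ℝ} (he₀ : 0 < e₀)
    (hκ₁0 : 0 ≤ κ₁) (hκ₁ : κ₁ < B.Dtmin) (hκ₂0 : 0 ≤ κ₂) :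
    ∃ c₃ : ℝ, 0 < c₃ ∧ ∀ (δ : (Fin 2 → ℝ) → ℝ), ContDiff ℝ 2 δ → (∀ k : Fin 2 → ℝ, |δ k| ≤ κ₀) →
      (∀ k : Fin 2 → ℝ, ‖fderiv ℝ δ k‖ ≤ κ₁) → (∀ k : Fin 2 → ℝ, ‖fderiv ℝ (fderiv ℝ δ) k‖ ≤ κ₂) →
      ∀ μ : ℝ, a ≤ μ - κ₀ - e₀ → μ + κ₀ + e₀ ≤ b →
      ∀ (n ω : ℕ), ω < sectorCount n →
      ∀ p ∈ BGM2003.sSector (fun ϑ e => perturbedFermiRadius δ (μ + e) ϑ) e₀ n ω,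
      ∃ k₁ k₂ : ℝ,
        p = BGM2003.fermiPoint (fun ϑ e => perturbedFermiRadius δ (μ + e) ϑ) (sectorCenter n ω) +
              k₁ • BGM2003.unitNormal (fun ϑ e => perturbedFermiRadius δ (μ + e) ϑ) (sectorCenter n ω) 0 +
              k₂ • BGM2003.unitTangent (fun ϑ e => perturbedFermiRadius δ (μ + e) ϑ) (sectorCenter n ω) 0 ∧
        |k₁| ≤ c₃ * (4 : ℝ) ^ (-(n : ℤ)) ∧ |k₂| ≤ c₃ * (2 : ℝ) ^ (-(n : ℤ)) ∧
        |fderiv ℝ (fun k => sqDispersion k + δ k) p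
            (BGM2003.unitTangent (fun ϑ e => perturbedFermiRadius δ (μ + e) ϑ) (sectorCenter n ω) 0)| ≤ c₃ * (2 : ℝ) ^ (-(n : ℤ)) := by
  have hDt := B.Dtmin_pos; have hum := B.umin_pos; have hsm := B.smax_pos; have hπ := Real.pi_pos
  have hden : 0 < B.Dtmin - κ₁ := sub_pos.2 hκ₁
  -- the constants
  set SE := B.smax + κ₁ * (π * Real.sqrt 2 + 2 * B.smax) / (B.Dtmin - κ₁) with hSE
  set AE := ((4 + κ₂) * (B.smax + κ₁ * (π * Real.sqrt 2 + 2 * B.smax) / (B.Dtmin - κ₁)) ^ 2 +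
            (8 + 2 * κ₁) * ((4 + κ₁) * (π * Real.sqrt 2) / (B.Dtmin - κ₁)) + (4 + κ₁) * (π * Real.sqrt 2)) / (B.Dtmin - κ₁) +
          2 * ((4 + κ₁) * (π * Real.sqrt 2) / (B.Dtmin - κ₁)) + π * Real.sqrt 2 with hAE
  have hSE0 : 0 ≤ SE := by rw [hSE]; positivity
  have hAE0 : 0 ≤ AE := by rw [hAE]; positivity
  set R₂ := (e₀ + B.smax * B.Dtmin * (3 * π / 4)) / (B.Dtmin - κ₁) with hR₂
  have hR₂0 : 0 ≤ R₂ := by rw [hR₂]; positivity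
  set R₁ := (2 * SE * e₀ / (B.Dtmin - κ₁) + 2 * SE * AE * (3 * π / 4) ^ 2) / B.umin with hR₁
  have hR₁0 : 0 ≤ R₁ := by rw [hR₁]; positivity
  refine ⟨R₁ + 2 * R₂ + (4 + κ₂) * SE * R₂ / B.umin + 1, by positivity, ?_⟩
  intro δ hδs hδ hκ hκ₂ μ hlo hhi n ω hω p hp
  have h2ne : (2 : WithTop ℕ∞) ≠ 0 := by norm_num
  have hδc : Continuous δ := hδs.continuous
  have hδ' : ∀ k : Fin 2 → ℝ, (∀ i, |k i| ≤ π) → |δ k| ≤ κ₀ := fun k _ => hδ k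
  have hκ' : ∀ k : Fin 2 → ℝ, (∀ i, |k i| ≤ π) → ‖fderiv ℝ δ k‖ ≤ κ₁ := fun k _ => hκ k
  have hκ₂' : ∀ k : Fin 2 → ℝ, (∀ i, |k i| ≤ π) → ‖fderiv ℝ (fderiv ℝ δ) k‖ ≤ κ₂ := fun k _ => hκ₂ k
  have hdiff : ∀ k, DifferentiableAt ℝ δ k := fun k => (hδs.differentiable h2ne) k
  have hlo0 : a ≤ μ - κ₀ := by linarith
  have hhi0 : μ + κ₀ ≤ b := by linarith
  -- the level-`μ` root selection `U`
  set U : ℝ → ℝ := perturbedFermiRadius δ μ with hU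
  have hu : ∀ θ, IsBandFermiRadius (μ - δ (U θ • dir θ)) θ (U θ) := isBandFermiRadius_perturbedFermiRadius B hδc hδ' hlo0 hhi0
  have hLip : ∀ k k' : Fin 2 → ℝ, (∀ i, |k i| ≤ π) → (∀ i, |k' i| ≤ π) → |δ k - δ k'| ≤ κ₁ * ‖k - k'‖ :=
    fun k k' hk hk' => lipschitz_of_fderiv_le (fun k _ => hdiff k) hκ' hk hk'
  obtain ⟨θ₀, e, he, hζ, rfl⟩ := hp
  -- the data of the sector
  set w := sectorWidth n with hwdef
  have hwpos : 0 < w := sectorWidth_pos n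
  have hw2 : w = π * (2 : ℝ) ^ (-(n : ℤ)) := sectorWidth_eq_pi_mul n
  have h2n : 0 < (2 : ℝ) ^ (-(n : ℤ)) := by positivity
  have h4n : (4 : ℝ) ^ (-(n : ℤ)) = ((2 : ℝ) ^ (-(n : ℤ))) ^ 2 := four_zpow_neg_eq_sq n
  have h42 : (4 : ℝ) ^ (-(n : ℤ)) ≤ (2 : ℝ) ^ (-(n : ℤ)) := four_zpow_neg_le_two_zpow_neg n
  have he' : |e| ≤ e₀ := he.trans (by
    have : (4 : ℝ) ^ (-(n : ℤ)) ≤ 1 := zpow_le_one_of_nonpos₀ (by norm_num) (by simp)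
    nlinarith)
  have hloe : a ≤ μ + e - κ₀ := by have := (abs_le.1 he').1; linarith
  have hhie : μ + e + κ₀ ≤ b := by have := (abs_le.1 he').2; linarith
  -- shift the angle into the window around the centre
  set θc := sectorCenter n ω with hθc
  obtain ⟨kz, hkz⟩ := exists_abs_lt_of_sectorWeightCirc_ne_zero hζ
  set θ := θ₀ - 2 * π * kz with hθdef
  have hθc' : |θ - θc| ≤ 3 * w / 4 := by
    rw [hθc, sectorCenter, hθdef]
    have e1 : θ₀ - 2 * π * ↑kz - ((ω : ℝ) + 1 / 2) * sectorWidth n = θ₀ - (((ω : ℕ) : ℤ) + 1 / 2 : ℝ) * sectorWidth n - 2 * π * kz := by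
      push_cast; ring
    rw [e1]; exact hkz.le
  have hper : Function.Periodic (perturbedFermiRadius δ (μ + e)) (2 * π) := fun ϑ => perturbedFermiRadius_add_two_pi δ (μ + e) ϑ
  have hperd : Function.Periodic dir (2 * π) := fun ϑ => dir_add_two_pi ϑ
  have hpt : BGM2003.levelPoint (fun ϑ e => perturbedFermiRadius δ (μ + e) ϑ) θ₀ e = perturbedFermiRadius δ (μ + e) θ • dir θ := by
    show perturbedFermiRadius δ (μ + e) θ₀ • dir θ₀ = _
    have e1 : θ₀ = θ + kz * (2 * π) := by rw [hθdef]; ring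
    rw [e1, hper.int_mul kz, hperd.int_mul kz]
  rw [hpt]
  -- the two root selections on the ray `θ`
  set t := perturbedFermiRadius δ (μ + e) θ with ht
  have htroot : IsBandFermiRadius (μ + e - δ (t • dir θ)) θ t := isBandFermiRadius_perturbedFermiRadius B hδc hδ' hloe hhie θ
  have hrad : |t - U θ| ≤ |e| / (B.Dtmin - κ₁) :=
    abs_radius_sub_radius_le_of_levels B hδ hlo0 hhi0 hκ hκ₁ hu hdiff hloe hhie htroot
  -- the frame at the centre
  set VX := VXE U θc with hVXdef
  set VY := VYE U θc with hVYdef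
  obtain ⟨hvx, hvy⟩ := abs_VXE_le B hδs h2ne hδ' hlo0 hhi0 hκ' hκ₁ hu θc
  rw [← hSE] at hvx hvy
  have hUc : B.umin ≤ U θc := umin_le_of_shifted B hδ' hlo0 hhi0 (hu θc)
  have hUcpos : 0 < U θc := hum.trans_le hUc
  have hsq : deriv U θc ^ 2 + U θc ^ 2 = VX ^ 2 + VY ^ 2 := deriv_sq_add_sq_eq_VXE U θc
  have hs : 0 < VX ^ 2 + VY ^ 2 := by rw [← hsq]; positivity
  set sp := Real.sqrt (VX ^ 2 + VY ^ 2) with hspdef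
  have hsp0 : 0 < sp := Real.sqrt_pos.2 hs
  have hspU : U θc ≤ sp := by
    rw [hspdef, ← hsq]
    calc U θc = Real.sqrt (U θc ^ 2) := (Real.sqrt_sq hUcpos.le).symm
      _ ≤ Real.sqrt (deriv U θc ^ 2 + U θc ^ 2) := Real.sqrt_le_sqrt (by nlinarith)
  have hspmin : B.umin ≤ sp := hUc.trans hspU
  -- the displacement `wv = p − p_F(θc)` and its size
  set wv : Fin 2 → ℝ := t • dir θ - U θc • dir θc with hwv
  have hcurve : ‖U θ • dir θ - U θc • dir θc‖ ≤ B.smax * B.Dtmin * |θ - θc| / (B.Dtmin - κ₁) :=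
    norm_root_sub_root_le B hδ' hLip hκ₁ hu hlo0 hhi0 θ θc
  have hwvi : ∀ i, |wv i| ≤ R₂ * (2 : ℝ) ^ (-(n : ℤ)) := by
    intro i
    have hdi : |dir θ i| ≤ 1 := by
      rw [← Real.norm_eq_abs]; exact (norm_le_pi_norm (dir θ) i).trans (norm_dir_le_one θ)
    have e1 : wv i = (t - U θ) * dir θ i + (U θ • dir θ - U θc • dir θc) i := by
      simp only [hwv, Pi.sub_apply, Pi.smul_apply, smul_eq_mul]; ring
    rw [e1]
    have h1 : |(t - U θ) * dir θ i| ≤ |e| / (B.Dtmin - κ₁) := by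
      rw [abs_mul]
      calc |t - U θ| * |dir θ i| ≤ |e| / (B.Dtmin - κ₁) * 1 := mul_le_mul hrad hdi (abs_nonneg _) (by positivity)
        _ = _ := mul_one _
    have h2 : |(U θ • dir θ - U θc • dir θc) i| ≤ B.smax * B.Dtmin * |θ - θc| / (B.Dtmin - κ₁) :=
      le_trans (by rw [← Real.norm_eq_abs]; exact norm_le_pi_norm _ i) hcurve
    have h3 : |e| / (B.Dtmin - κ₁) ≤ e₀ * (2 : ℝ) ^ (-(n : ℤ)) / (B.Dtmin - κ₁) :=
      div_le_div_of_nonneg_right (he.trans (by nlinarith [he₀.le])) hden.le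
    have h4 : B.smax * B.Dtmin * |θ - θc| / (B.Dtmin - κ₁) ≤ B.smax * B.Dtmin * (3 * π / 4 * (2 : ℝ) ^ (-(n : ℤ))) / (B.Dtmin - κ₁) := by
      refine div_le_div_of_nonneg_right (mul_le_mul_of_nonneg_left ?_ (by positivity)) hden.le
      calc |θ - θc| ≤ 3 * w / 4 := hθc'
        _ = 3 * π / 4 * (2 : ℝ) ^ (-(n : ℤ)) := by rw [hw2]; ring
    calc |(t - U θ) * dir θ i + (U θ • dir θ - U θc • dir θc) i|
        ≤ |(t - U θ) * dir θ i| + |(U θ • dir θ - U θc • dir θc) i| := abs_add_le _ _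
      _ ≤ e₀ * (2 : ℝ) ^ (-(n : ℤ)) / (B.Dtmin - κ₁) + B.smax * B.Dtmin * (3 * π / 4 * (2 : ℝ) ^ (-(n : ℤ))) / (B.Dtmin - κ₁) :=
          add_le_add (h1.trans h3) (h2.trans h4)
      _ = R₂ * (2 : ℝ) ^ (-(n : ℤ)) := by rw [hR₂]; field_simp
  -- the coefficients
  set k₁ := (wv 0 * VY - wv 1 * VX) / sp with hk₁
  set k₂ := (wv 0 * VX + wv 1 * VY) / sp with hk₂
  have hdec := frame_decomp_VXE δ μ θc hs wv
  refine ⟨k₁, k₂, ?_, ?_, ?_, ?_⟩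
  · -- the decomposition
    rw [fermiPoint_chart]
    have e1 : t • dir θ = U θc • dir θc + wv := by rw [hwv]; abel
    rw [e1, hdec]
    simp only [hk₁, hk₂, hVXdef, hVYdef, hspdef]
    abel
  · -- the normal coefficient: level shift + second-order deviation
    have hnum : wv 0 * VY - wv 1 * VX = (t - U θ) * (Real.cos θ * VY - Real.sin θ * VX) +
        ((XE U θ - XE U θc) * VY - (YE U θ - YE U θc) * VX) := by
      simp only [hwv, Pi.sub_apply, Pi.smul_apply, smul_eq_mul, dir_zero, dir_one, XE, YE]; ring
    have hdev := abs_normalDeviation_le B hδs hδ hlo0 hhi0 hκ hκ₁ hκ₂ hu θc θ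
    rw [← hSE, ← hAE] at hdev
    have hA : |(t - U θ) * (Real.cos θ * VY - Real.sin θ * VX)| ≤ |e| / (B.Dtmin - κ₁) * (2 * SE) := by
      rw [abs_mul]
      refine mul_le_mul hrad ?_ (abs_nonneg _) (by positivity)
      calc |Real.cos θ * VY - Real.sin θ * VX| ≤ |Real.cos θ * VY| + |Real.sin θ * VX| := abs_sub _ _
        _ = |Real.cos θ| * |VY| + |Real.sin θ| * |VX| := by rw [abs_mul, abs_mul]
        _ ≤ 1 * SE + 1 * SE := add_le_add (mul_le_mul (Real.abs_cos_le_one θ) hvy (abs_nonneg _) zero_le_one)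
            (mul_le_mul (Real.abs_sin_le_one θ) hvx (abs_nonneg _) zero_le_one)
        _ = 2 * SE := by ring
    have hθsq : (θ - θc) ^ 2 ≤ (3 * π / 4) ^ 2 * (4 : ℝ) ^ (-(n : ℤ)) := by
      rw [h4n, ← mul_pow]
      have h0 : 0 ≤ 3 * π / 4 * (2 : ℝ) ^ (-(n : ℤ)) := by positivity
      have h1 : |θ - θc| ≤ 3 * π / 4 * (2 : ℝ) ^ (-(n : ℤ)) := by
        calc |θ - θc| ≤ 3 * w / 4 := hθc'
          _ = 3 * π / 4 * (2 : ℝ) ^ (-(n : ℤ)) := by rw [hw2]; ring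
      rw [← sq_abs]; exact pow_le_pow_left₀ (abs_nonneg _) h1 2
    have htot : |wv 0 * VY - wv 1 * VX| ≤ (2 * SE * e₀ / (B.Dtmin - κ₁) + 2 * SE * AE * (3 * π / 4) ^ 2) * (4 : ℝ) ^ (-(n : ℤ)) := by
      rw [hnum]
      refine (abs_add_le _ _).trans ?_
      have h1 : |e| / (B.Dtmin - κ₁) * (2 * SE) ≤ 2 * SE * e₀ / (B.Dtmin - κ₁) * (4 : ℝ) ^ (-(n : ℤ)) := by
        have := div_le_div_of_nonneg_right he hden.le
        have e2 : 2 * SE * e₀ / (B.Dtmin - κ₁) * (4 : ℝ) ^ (-(n : ℤ)) = (4 : ℝ) ^ (-(n : ℤ)) * e₀ / (B.Dtmin - κ₁) * (2 * SE) := by ring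
        rw [e2]; exact mul_le_mul_of_nonneg_right this (by positivity)
      have h2 : |(XE U θ - XE U θc) * VY - (YE U θ - YE U θc) * VX| ≤ 2 * SE * AE * (3 * π / 4) ^ 2 * (4 : ℝ) ^ (-(n : ℤ)) :=
        hdev.trans (by rw [mul_assoc (2 * SE * AE)]; exact mul_le_mul_of_nonneg_left hθsq (by positivity))
      linarith
    rw [hk₁, abs_div, abs_of_pos hsp0, div_le_iff₀ hsp0]
    calc |wv 0 * VY - wv 1 * VX| ≤ (2 * SE * e₀ / (B.Dtmin - κ₁) + 2 * SE * AE * (3 * π / 4) ^ 2) * (4 : ℝ) ^ (-(n : ℤ)) := htot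
      _ = R₁ * (4 : ℝ) ^ (-(n : ℤ)) * B.umin := by rw [hR₁]; field_simp
      _ ≤ R₁ * (4 : ℝ) ^ (-(n : ℤ)) * sp := mul_le_mul_of_nonneg_left hspmin (by positivity)
      _ ≤ (R₁ + 2 * R₂ + (4 + κ₂) * SE * R₂ / B.umin + 1) * (4 : ℝ) ^ (-(n : ℤ)) * sp := by
          gcongr; linarith [show 0 ≤ (4 + κ₂) * SE * R₂ / B.umin by positivity]
  · -- the tangential coefficient: cell size
    have h := abs_tangentCoeff_le δ μ θc hs wv hwvi
    calc |k₂| ≤ 2 * (R₂ * (2 : ℝ) ^ (-(n : ℤ))) := h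
      _ = 2 * R₂ * (2 : ℝ) ^ (-(n : ℤ)) := by ring
      _ ≤ _ := by
          refine mul_le_mul_of_nonneg_right ?_ h2n.le
          linarith [show 0 ≤ (4 + κ₂) * SE * R₂ / B.umin by positivity]
  · -- the tangential derivative: tangency at the centre + Lipschitz of the gradient
    obtain ⟨ht0, ht1⟩ := unitTangent_chart_apply δ μ θc
    have hτ : BGM2003.unitTangent (fun ϑ e => perturbedFermiRadius δ (μ + e) ϑ) θc 0 = sp⁻¹ • (![VX, VY] : Fin 2 → ℝ) := by
      ext i; fin_cases i
      · simpa [hVXdef, hVYdef, hspdef] using ht0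
      · simpa [hVXdef, hVYdef, hspdef] using ht1
    rw [hτ, map_smul, smul_eq_mul, abs_mul, abs_inv, abs_of_pos hsp0]
    -- the gradient along `v = (X_E′, Y_E′)(θc)` vanishes at `p_F(θc)`
    have hd0 : DifferentiableAt ℝ sqDispersion (t • dir θ) := (contDiff_sqDispersion.differentiable one_ne_zero).differentiableAt
    have hgrad : fderiv ℝ (fun k => sqDispersion k + δ k) (t • dir θ) ![VX, VY] =
        2 * Real.sin ((t • dir θ) 0) * VX + 2 * Real.sin ((t • dir θ) 1) * VY + fderiv ℝ δ (t • dir θ) ![VX, VY] := by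
      show fderiv ℝ (sqDispersion + δ) (t • dir θ) ![VX, VY] = _
      rw [fderiv_add hd0 (hdiff _), add_apply, fderiv_sqDispersion_apply]
      simp
    have hu2 : ContDiff ℝ 2 U := contDiff_of_isRoot B hδs h2ne hδ' hlo0 hhi0 hκ' hκ₁ hu
    have hroot : ∀ θ, sqDispersion (U θ • dir θ) + δ (U θ • dir θ) = μ := fun ϑ => by
      have h := (hu ϑ).2; simp only [rayDispersion] at h; linarith
    have htan := levelIdentity_one hδs hu2 hroot θc
    rw [← hVXdef, ← hVYdef] at htan
    -- compare the two gradients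
    have hX : |2 * Real.sin ((t • dir θ) 0) * VX - 2 * Real.sin (XE U θc) * VX| ≤ 2 * SE * (R₂ * (2 : ℝ) ^ (-(n : ℤ))) := by
      have e1 : 2 * Real.sin ((t • dir θ) 0) * VX - 2 * Real.sin (XE U θc) * VX = 2 * VX * (Real.sin ((t • dir θ) 0) - Real.sin (XE U θc)) := by ring
      rw [e1, abs_mul, abs_mul, abs_two]
      have hw0 : (t • dir θ) 0 - XE U θc = wv 0 := by simp [hwv, XE]
      have hs : |Real.sin ((t • dir θ) 0) - Real.sin (XE U θc)| ≤ R₂ * (2 : ℝ) ^ (-(n : ℤ)) :=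
        (Real.abs_sin_sub_sin_le ((t • dir θ) 0) (XE U θc)).trans (by rw [hw0]; exact hwvi 0)
      have h1 : |VX| * |Real.sin ((t • dir θ) 0) - Real.sin (XE U θc)| ≤ SE * (R₂ * (2 : ℝ) ^ (-(n : ℤ))) :=
        mul_le_mul hvx hs (abs_nonneg _) hSE0
      linarith
    have hY : |2 * Real.sin ((t • dir θ) 1) * VY - 2 * Real.sin (YE U θc) * VY| ≤ 2 * SE * (R₂ * (2 : ℝ) ^ (-(n : ℤ))) := by
      have e1 : 2 * Real.sin ((t • dir θ) 1) * VY - 2 * Real.sin (YE U θc) * VY = 2 * VY * (Real.sin ((t • dir θ) 1) - Real.sin (YE U θc)) := by ring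
      rw [e1, abs_mul, abs_mul, abs_two]
      have hw1 : (t • dir θ) 1 - YE U θc = wv 1 := by simp [hwv, YE]
      have hs : |Real.sin ((t • dir θ) 1) - Real.sin (YE U θc)| ≤ R₂ * (2 : ℝ) ^ (-(n : ℤ)) :=
        (Real.abs_sin_sub_sin_le ((t • dir θ) 1) (YE U θc)).trans (by rw [hw1]; exact hwvi 1)
      have h1 : |VY| * |Real.sin ((t • dir θ) 1) - Real.sin (YE U θc)| ≤ SE * (R₂ * (2 : ℝ) ^ (-(n : ℤ))) :=
        mul_le_mul hvy hs (abs_nonneg _) hSE0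
      linarith
    have hnv : ‖(![VX, VY] : Fin 2 → ℝ)‖ ≤ SE := norm_vec2_le hSE0 hvx hvy
    have hnw : ‖t • dir θ - U θc • dir θc‖ ≤ R₂ * (2 : ℝ) ^ (-(n : ℤ)) :=
      (pi_norm_le_iff_of_nonneg (by positivity)).2 fun i => by rw [Real.norm_eq_abs]; exact hwvi i
    have hD : |fderiv ℝ δ (t • dir θ) ![VX, VY] - fderiv ℝ δ (U θc • dir θc) ![VX, VY]| ≤ κ₂ * SE * (R₂ * (2 : ℝ) ^ (-(n : ℤ))) := by
      refine (abs_fderiv_apply_sub_apply_le hδs hκ₂ ![VX, VY] (t • dir θ) (U θc • dir θc)).trans ?_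
      exact mul_le_mul (mul_le_mul_of_nonneg_left hnv hκ₂0) hnw (norm_nonneg _) (by positivity)
    have hval : |fderiv ℝ (fun k => sqDispersion k + δ k) (t • dir θ) ![VX, VY]| ≤ (4 + κ₂) * SE * (R₂ * (2 : ℝ) ^ (-(n : ℤ))) := by
      rw [hgrad]
      have e1 : 2 * Real.sin ((t • dir θ) 0) * VX + 2 * Real.sin ((t • dir θ) 1) * VY + fderiv ℝ δ (t • dir θ) ![VX, VY] =
          (2 * Real.sin ((t • dir θ) 0) * VX - 2 * Real.sin (XE U θc) * VX) +
          (2 * Real.sin ((t • dir θ) 1) * VY - 2 * Real.sin (YE U θc) * VY) +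
          (fderiv ℝ δ (t • dir θ) ![VX, VY] - fderiv ℝ δ (U θc • dir θc) ![VX, VY]) +
          (2 * Real.sin (XE U θc) * VX + 2 * Real.sin (YE U θc) * VY + fderiv ℝ δ (U θc • dir θc) ![VX, VY]) := by ring
      rw [e1, htan, add_zero]
      refine (abs_add_le _ _).trans ((add_le_add ((abs_add_le _ _).trans (add_le_add hX hY)) hD).trans ?_)
      exact le_of_eq (by ring)
    calc sp⁻¹ * |fderiv ℝ (fun k => sqDispersion k + δ k) (t • dir θ) ![VX, VY]|
        ≤ B.umin⁻¹ * ((4 + κ₂) * SE * (R₂ * (2 : ℝ) ^ (-(n : ℤ)))) :=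
          mul_le_mul (inv_anti₀ hum hspmin) hval (abs_nonneg _) (by positivity)
      _ = (4 + κ₂) * SE * R₂ / B.umin * (2 : ℝ) ^ (-(n : ℤ)) := by field_simp
      _ ≤ _ := by
          refine mul_le_mul_of_nonneg_right ?_ h2n.le
          linarith


end Summit.HubbardSuperconductivity.HubbardSuperconductivity.Theorems.PerturbedFermiCurve

end
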